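/-
Copyright (c) 2026 the pub-hodgecm-mathlib formalisation cell (harness21).  Prover seat hodgecm-mathlib-F0P3-p02 (g27); E1 keeper ∕ dealer F0P3a-p03 (g31); EXT-ROAD
«12.6.1 (b)-REST VIA THE EP DEFECT + BLOCK SEPARATION» (census LH6-p04 (g12) v1), brick (X0) «PAIR TRACE IDENTITY», DATUM FILE A (2026-09-03).
-/
import Summits.HodgeConjecture.HodgeConjecture.Theorems.F0P3cStCharTSEPTraceOneAtDatum   -- ★ row 59 (F0P3-p01 g24) p853501∕p853506: §0 `finiteDimensional_intertwiningMap_of_trivial_on`; brings ★ 57-B (+ ED. 2 p853764 §5 `finiteDimensional_intertwiningMap_zero∕oneChains`), ★ F-gen2, ★ 42, ★ PCT-OUT, ★ 48-datum FILE 1, ★ 41g-H letters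
import Literature.NumberTheory.Automorphic.SmoothCharacterEPFunctionTracePair                 -- ROW 80 GENERIC HALF (this seat): `Representation.smoothTrace_epTwoFamilies_eq_finrank_sub` (★ 42 term by term on the traced `π′` + two bridges)
import HarnessLib

/-!
# F0 · P3c · «StCharTS» EXT-ROAD brick (X0), FILE A — THE PAIR TRACE IDENTITY AT THE DATUM `tr π′(f_EP^π) = dim Hom_G(C₀(X)^π, π′) − dim Hom_G(C₁(X)^π, π′)` on the `U(Φ₃)(L⁺_v)`
# tree (`v` non-split UNRAMIFIED), for EVERY pair of irreducible smooth `π = [r]`, `π′ = [r′]`; `⟨χ_{π′}, χ_π⟩_e` equals it when `f_EP^π` is a pseudo-coefficient; CROSS-TRACE-ZERO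

Cell `pub/hodgecm-mathlib` (D-0151), crux H413 = `stmt-HodgeConjecture-24833` (`--supports` lane, `--as helper`: THEOREMS ONLY — no definition ∕ instance ∕ notation ∕ named fact ∕
`sorry`; count-neutral).  Namespace `Summit.HodgeConjecture.HodgeConjecture.Cruxes.H413.F0P3cStCharTSEPTracePairAtDatum`.  Seat F0P3-p02 (g27) (★ 57-B's author: its two BRIDGES
`finrank_intertwiningMap_zeroChains_eq_sum` ∕ `…oneChains_eq_sum` are stated for an ARBITRARY target — exactly what a pair spends); keeper F0P3a-p03 (g31) k107 (ROW 80).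
THE MATHEMATICS ([SchneiderStuhler1997, §III.4]; [Kottwitz1988, §2]): for an irreducible smooth `σ = r.ρ` of `G = Gqs L v` the Schneider–Stuhler resolution on the tree `X` is a SMOOTH
length-one presentation `0 → C₁(X)^σ → C₀(X)^σ → σ → 0` with `C_q(X)^σ ≅ ⊕_{orbits} c-Ind_P^G σ_P` (★ 57-B), and for EVERY admissible `π′` (★ 42 term by term + ★ 45 + the bridges
at target `π′`): **`tr π′(f_EP^σ) = dim Hom_G(C₀(X)^σ, π′) − dim Hom_G(C₁(X)^σ, π′)`.**  This file is the `r ↦ (r, r′)` twin of ★ row 59 `F0P3cStCharTSEPTraceOneAtDatum` with the two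
`= 1`-only inputs (`hsplit`, Schur) DELETED; the presentation is EXPORTED once (an `∃` over its carriers) with the identity for every traced `r′` — the shape ★ row 77 (X1)
`exists_nonsplit_extension_of_finrank_ne_of_subsingleton` eats — and the CROSS-TRACE-ZERO corollary (EXT-ROAD v2 (S-A), keeper k107) is drawn through ★ (J′).
* GENERIC HALF `Literature/…/SmoothCharacterEPFunctionTracePair`: `Representation.smoothTrace_epTwoFamilies_eq_finrank_sub` (★ 42 term by term on the traced `π′` + two bridges).
* §1 **`exists_presentation_smoothTrace_epTwoFamilies_eq_finrank_sub_at_datum`** — THE TRACE SIDE: binders = ★ `smoothTrace_epTwoFamilies_eq_one_at_datum`'s VERBATIM minus `hsplit`.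
* §2 **`exists_presentation_innerG_char_eq_finrank_sub_of_isPseudoCoeff_epTwoFamilies`** — THE PAIRING at a §12.5 datum with ★ PCT-OUT's letters: IF `f_EP^σ` is a pseudo-coefficient
  of `[r]` (`hpc`, row 58's witnessed head) THEN `⟨χ_{[r′]}, χ_{[r]}⟩_e = dim Hom_G(C₀^σ, r′) − dim Hom_G(C₁^σ, r′)` for every `r′` (★ PCT-OUT `pseudoCoeffTrace_Gqs`).
* §3 **`smoothTrace_epTwoFamilies_eq_zero_of_forall_extension_split_of_subsingleton_hom`** — CROSS-TRACE-ZERO: `hsplit₂` (every SMOOTH extension of `r` BY `r′` splits, ★ (J′)'s letters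
  at `V := r.ρ`, `W := r′.ρ`) + `hHom0 : Subsingleton Hom_G(r, r′)` ⇒ `tr r′(f_EP^r) = 0` (§1 ∘ ★ (J′) `finrank_intertwiningMap_presentation_of_isSmooth`).
* §4 **`innerG_char_eq_zero_of_forall_extension_split_of_isPseudoCoeff_epTwoFamilies`** — CROSS-NORM-ZERO: the same through ★ PCT-OUT, `⟨χ_{[r′]}, χ_{[r]}⟩_e = 0`.
NO `IsL2` ∕ `IsEllipticRep` ∕ `IsSupercuspidal` ∕ unitarity ∕ self-`hsplit` letter anywhere.  HONEST LABEL: count-neutral helper; Prop. 12.6.1 (b)-rest stays PRINT of record until a LEAD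
prices EXT-ROAD v2; h413 OPEN; HC_CM is proved only modulo the 7 printed citations (2 remaining named inputs hLiu418 = stmt-HodgeConjecture-24832, h413 = stmt-HodgeConjecture-24833)
until rung 0 closes; nothing printed is asserted here.

## References
* [SchneiderStuhler1997] P. Schneider, U. Stuhler, *Representation theory and sheaves on the Bruhat–Tits building*, Publ. Math. IHÉS 85 (1997): Thm. II.3.1, §III.4 Thm. III.4.16 ff.
* [Kottwitz1988] R. E. Kottwitz, *Tamagawa numbers*, Ann. of Math. 127 (1988): §2 Theorem 2 (the Euler–Poincaré function).
* [Rogawski1990] J. D. Rogawski, *Automorphic Representations of Unitary Groups in Three Variables*, Ann. of Math. Stud. 123 (1990): §12.6 p. 187, Prop. 12.6.1 (b) p. 188.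
* [BernsteinZelevinsky1976] I. N. Bernstein, A. V. Zelevinsky, *Representations of the group GL(n, F)*, Russian Math. Surveys 31 (1976): §2.1–§2.4.
* [BruhatTits1972] F. Bruhat, J. Tits, *Groupes réductifs sur un corps local I*, Publ. Math. IHÉS 41 (1972): §10 (the tree of `U(3)` at an unramified place).
-/

set_option autoImplicit false

set_option linter.dupNamespace false

noncomputable section

open NumberField IsDedekindDomain MeasureTheory Measure Filter Topology
open scoped Pointwise Valued WithZero Matrix MatrixGroups BigOperators
open Literature.NumberTheory.Rogawski1990 Literature.NumberTheory.Rogawski1990.Ch12Sec5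
open Literature.NumberTheory.Automorphic Literature.NumberTheory.Automorphic.UnitaryGroup Literature.NumberTheory.Automorphic.UnitaryLatticeTree
open Literature.NumberTheory.Automorphic.HermitianLattice Literature.NumberTheory.GaloisRepresentations
open Literature.Combinatorics.SimpleGraph Literature.Combinatorics.SimpleGraph.OrientedIncidence

namespace Summit.HodgeConjecture.HodgeConjecture.Cruxes.H413.F0P3cStCharTSEPTracePairAtDatum

open Summit.HodgeConjecture.HodgeConjecture.Cruxes.H413
open Summit.HodgeConjecture.HodgeConjecture.Cruxes.H413.F0P3cStCharTSCharacterEllipticUniform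
open Summit.HodgeConjecture.HodgeConjecture.Cruxes.H413.F0P3cStCharTSEPFunctionOrbitalOrbits
open Summit.HodgeConjecture.HodgeConjecture.Cruxes.H413.F0P3cStCharTSEPTraceOneAtDatum

section Head

variable (L : Type) [Field L] [NumberField L] [IsCMField L] (v : HeightOneSpectrum (𝓞 ↥(maximalRealSubfield L)))

/-! ## §1 THE TRACE SIDE at the datum, for a pair `(r, r′)` — the presentation of `r` exported -/

set_option maxHeartbeats 1600000 in
/-- **THE PAIR TRACE IDENTITY AT THE DATUM.**  At a non-split UNRAMIFIED place `v` ((G3) letters `(w hw ϖ hd eA)`), for the action hom `a` and the unitary level family `U` at level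
`ϖ^(e+1)` (★ 41g-H, hypothesis-style `ha hU`), a Haar measure `νQv`, an invariant orientation `τ` of the tree, an irreducible smooth `r : SmoothIrrep (Gqs L v)` with
`r.ρ.fixedPoints (U x₀) ≠ ⊥`, ORBIT DATA for vertices (`ι₀`, `xv idx₀ tr₀ P₀ σ₀`) and edges (`ι₁`, `xe idx₁ tr₁ P₁ σ₁`) in ★ 57-B's letters and `K`-type pieces `f₀ ∕ f₁` in ★ 42's
letters: there is a SMOOTH length-one presentation `0 → (M₁, ρ₁) —dC→ (M₀, ρ₀) —ε→ r.ρ → 0` (the Schneider–Stuhler chains of `r` on the tree, ★ F-gen2) such that for EVERY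
irreducible smooth `r′` the spaces `Hom_G(ρ₀, r′)`, `Hom_G(ρ₁, r′)` are finite-dimensional and
`tr r′(Σ_i μ(P₀ i)⁻¹ f₀ i − Σ_j μ(P₁ j)⁻¹ f₁ j) = dim Hom_G(ρ₀, r′) − dim Hom_G(ρ₁, r′)`.
Proof: ★ 42 term by term on the admissible `r′` (★ `isAdmissible_smoothIrrep`), the two BRIDGES ★ 57-B at target `r′.ρ`, finiteness by ★ 57-B's equivalences + ★ 45, smoothness of
the chains ★ 5a. [cite: SchneiderStuhler1997, §III.4 Thm. III.4.16] [cite: Kottwitz1988, §2 Theorem 2] [cite: Rogawski1990, §12.6 p. 187] [cite: BruhatTits1972, §10] -/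
theorem exists_presentation_smoothTrace_epTwoFamilies_eq_finrank_sub_at_datum
    (hns : ∀ w : PlacesOver L v, IsCMField.complexConj L • w.1 = w.1)
    (w : PlacesOver L v) (hw : IsCMField.complexConj L • w.1 = w.1) {ϖ : (w.1.adicCompletion L)} (hd : UnramifiedLocalConjDatum (galAdicCompletionMap (L := L) (IsCMField.complexConj L) hw) ϖ)
    (eA : (Gqs L v) ≃ₜ* ↥(unitaryGroupOfForm (galAdicCompletionMap (L := L) (IsCMField.complexConj L) hw) ((StdForm.antidiagonal 3).over (w.1.adicCompletion L))))
    {a : (Gqs L v) →* ((latticeGraph (galAdicCompletionMap (L := L) (IsCMField.complexConj L) hw) ϖ ((StdForm.antidiagonal 3).over (w.1.adicCompletion L))) ≃g (latticeGraph (galAdicCompletionMap (L := L) (IsCMField.complexConj L) hw) ϖ ((StdForm.antidiagonal 3).over (w.1.adicCompletion L))))} (ha : ∀ g, a g = latticeGraphIso (galAdicCompletionMap (L := L) (IsCMField.complexConj L) hw) ϖ ((StdForm.antidiagonal 3).over (w.1.adicCompletion L)) (eA g))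
    [MeasurableSpace (Gqs L v)] [BorelSpace (Gqs L v)]
    (νQv : Measure (Gqs L v)) [νQv.IsHaarMeasure]
    (τ : Orientation (latticeGraph (galAdicCompletionMap (L := L) (IsCMField.complexConj L) hw) ϖ ((StdForm.antidiagonal 3).over (w.1.adicCompletion L)))) (hτ : ∀ d, τ.tail d < τ.head d)
    {e : ℕ} {U : {M : Submodule 𝒪[(w.1.adicCompletion L)] (Fin 3 → (w.1.adicCompletion L)) // IsVertex (galAdicCompletionMap (L := L) (IsCMField.complexConj L) hw) ϖ ((StdForm.antidiagonal 3).over (w.1.adicCompletion L)) M} → Subgroup (Gqs L v)}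
    (hU : ∀ x g, g ∈ U x ↔ mapGL ((eA g : ↥(unitaryGroupOfForm (galAdicCompletionMap (L := L) (IsCMField.complexConj L) hw) ((StdForm.antidiagonal 3).over (w.1.adicCompletion L)))) : GL (Fin 3) (w.1.adicCompletion L)) x.1 = x.1 ∧
      x.1.map ((Matrix.toLin' ((((eA g : ↥(unitaryGroupOfForm (galAdicCompletionMap (L := L) (IsCMField.complexConj L) hw) ((StdForm.antidiagonal 3).over (w.1.adicCompletion L)))) : GL (Fin 3) (w.1.adicCompletion L)) : Matrix (Fin 3) (Fin 3) (w.1.adicCompletion L)) - 1)).restrictScalars 𝒪[(w.1.adicCompletion L)]) ≤ scaleLattice (ϖ ^ (e + 1)) x.1)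
    (r : SmoothIrrep (Gqs L v)) {x₀ : {M : Submodule 𝒪[(w.1.adicCompletion L)] (Fin 3 → (w.1.adicCompletion L)) // IsVertex (galAdicCompletionMap (L := L) (IsCMField.complexConj L) hw) ϖ ((StdForm.antidiagonal 3).over (w.1.adicCompletion L)) M}} (he : r.ρ.fixedPoints (U x₀) ≠ ⊥)
    -- vertex orbit data (★ 57-B letters)
    {ι₀ : Type} [Fintype ι₀] [DecidableEq ι₀] (xv : ι₀ → {M : Submodule 𝒪[(w.1.adicCompletion L)] (Fin 3 → (w.1.adicCompletion L)) // IsVertex (galAdicCompletionMap (L := L) (IsCMField.complexConj L) hw) ϖ ((StdForm.antidiagonal 3).over (w.1.adicCompletion L)) M}) (idx₀ : {M : Submodule 𝒪[(w.1.adicCompletion L)] (Fin 3 → (w.1.adicCompletion L)) // IsVertex (galAdicCompletionMap (L := L) (IsCMField.complexConj L) hw) ϖ ((StdForm.antidiagonal 3).over (w.1.adicCompletion L)) M} → ι₀) (tr₀ : {M : Submodule 𝒪[(w.1.adicCompletion L)] (Fin 3 → (w.1.adicCompletion L)) // IsVertex (galAdicCompletionMap (L := L) (IsCMField.complexConj L)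 hw) ϖ ((StdForm.antidiagonal 3).over (w.1.adicCompletion L)) M} → Gqs L v)
    (hidx₀ : ∀ i, idx₀ (xv i) = i) (hidx₀a : ∀ (g : Gqs L v) (x : {M : Submodule 𝒪[(w.1.adicCompletion L)] (Fin 3 → (w.1.adicCompletion L)) // IsVertex (galAdicCompletionMap (L := L) (IsCMField.complexConj L) hw) ϖ ((StdForm.antidiagonal 3).over (w.1.adicCompletion L)) M}), idx₀ (a g x) = idx₀ x) (htr₀ : ∀ x, a (tr₀ x) (xv (idx₀ x)) = x)
    (P₀ : ι₀ → Subgroup (Gqs L v)) (hP₀ : ∀ i g, g ∈ P₀ i ↔ a g (xv i) = xv i)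
    (σ₀ : ∀ i, Representation ℂ ↥(P₀ i) ↥(r.ρ.fixedPoints (U (xv i))))
    (hσ₀ : ∀ (i : ι₀) (p : ↥(P₀ i)) (x : ↥(r.ρ.fixedPoints (U (xv i)))), ((σ₀ i p x : ↥(r.ρ.fixedPoints (U (xv i)))) : r.V) = r.ρ (p : Gqs L v) (x : r.V))
    -- edge orbit data (★ 57-B letters)
    {ι₁ : Type} [Fintype ι₁] [DecidableEq ι₁] (xe : ι₁ → (latticeGraph (galAdicCompletionMap (L := L) (IsCMField.complexConj L) hw) ϖ ((StdForm.antidiagonal 3).over (w.1.adicCompletion L))).edgeSet) (idx₁ : (latticeGraph (galAdicCompletionMap (L := L) (IsCMField.complexConj L) hw) ϖ ((StdForm.antidiagonal 3).over (w.1.adicCompletion L))).edgeSet → ι₁) (tr₁ : (latticeGraph (galAdicCompletionMap (L := L) (IsCMField.complexConj L) hw) ϖ ((StdForm.antidiagonal 3).over (w.1.adicCompletion L))).edgeSet → Gqs L v)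
    (hidx₁ : ∀ j, idx₁ (xe j) = j) (hidx₁a : ∀ (g : Gqs L v) (d : (latticeGraph (galAdicCompletionMap (L := L) (IsCMField.complexConj L) hw) ϖ ((StdForm.antidiagonal 3).over (w.1.adicCompletion L))).edgeSet), idx₁ ((a g).mapEdgeSet d) = idx₁ d)
    (htr₁ : ∀ d : (latticeGraph (galAdicCompletionMap (L := L) (IsCMField.complexConj L) hw) ϖ ((StdForm.antidiagonal 3).over (w.1.adicCompletion L))).edgeSet, (a (tr₁ d)).mapEdgeSet (xe (idx₁ d)) = d)
    (P₁ : ι₁ → Subgroup (Gqs L v)) (hP₁ : ∀ j g, g ∈ P₁ j ↔ (a g).mapEdgeSet (xe j) = xe j)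
    (σ₁ : ∀ j, Representation ℂ ↥(P₁ j) ↥(r.ρ.fixedPoints (U (τ.head (xe j)) ⊔ U (τ.tail (xe j)))))
    (hσ₁ : ∀ (j : ι₁) (p : ↥(P₁ j)) (x : ↥(r.ρ.fixedPoints (U (τ.head (xe j)) ⊔ U (τ.tail (xe j))))),
      ((σ₁ j p x : ↥(r.ρ.fixedPoints (U (τ.head (xe j)) ⊔ U (τ.tail (xe j))))) : r.V) = r.ρ (p : Gqs L v) (x : r.V))
    -- the `K`-type pieces (★ 42 letters)
    {f₀ : ι₀ → Gqs L v → ℂ} (hfP₀ : ∀ i (g : Gqs L v) (hg : g ∈ P₀ i), f₀ i g = (σ₀ i).character ⟨g, hg⟩⁻¹) (hf0₀ : ∀ i, ∀ g ∉ P₀ i, f₀ i g = 0)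
    {f₁ : ι₁ → Gqs L v → ℂ} (hfP₁ : ∀ j (g : Gqs L v) (hg : g ∈ P₁ j), f₁ j g = (σ₁ j).character ⟨g, hg⟩⁻¹) (hf0₁ : ∀ j, ∀ g ∉ P₁ j, f₁ j g = 0) :
    ∃ (M₁ M₀ : Type) (_ : AddCommGroup M₁) (_ : Module ℂ M₁) (_ : AddCommGroup M₀) (_ : Module ℂ M₀)
      (ρ₁ : Representation ℂ (Gqs L v) M₁) (ρ₀ : Representation ℂ (Gqs L v) M₀) (dC : ρ₁.IntertwiningMap ρ₀) (ε : ρ₀.IntertwiningMap r.ρ),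
      ρ₁.IsSmooth ∧ ρ₀.IsSmooth ∧ Function.Injective dC ∧ LinearMap.ker ε.toLinearMap = LinearMap.range dC.toLinearMap ∧ Function.Surjective ε ∧
      ∀ r' : SmoothIrrep (Gqs L v), ∃ (_ : FiniteDimensional ℂ (ρ₀.IntertwiningMap r'.ρ)) (_ : FiniteDimensional ℂ (ρ₁.IntertwiningMap r'.ρ)),
        r'.ρ.smoothTrace νQv ((∑ i, ((νQv.real (P₀ i : Set (Gqs L v)) : ℂ))⁻¹ • f₀ i) - ∑ j, ((νQv.real (P₁ j : Set (Gqs L v)) : ℂ))⁻¹ • f₁ j) =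
          (Module.finrank ℂ (ρ₀.IntertwiningMap r'.ρ) : ℂ) - (Module.finrank ℂ (ρ₁.IntertwiningMap r'.ρ) : ℂ) := by
  classical
  haveI : r.ρ.IsIrreducible := r.isIrreducible
  haveI : Nontrivial r.V := Representation.IsIrreducible.nontrivial r.ρ
  haveI : NonarchimedeanGroup (Gqs L v) :=
    nonarchimedeanGroup_unitaryGroupOfForm_local (E := L) (c := IsCMField.complexConj L) (N := 3) (v := v) (J' := (adelicForm L 3 (qsForm L)).map (adeleToLocal L v))
  have hadm : r.ρ.IsAdmissible := F0P3cStCharTSScTracePackage.isAdmissible_smoothIrrep L v hns r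
  have hρ : r.ρ.IsSmooth := r.isSmooth
  -- the tree letters at the datum (★ 41g-H §2)
  have hT := isTree_latticeGraph_three_of_unramified hd
  have hstab := fun x : {M : Submodule 𝒪[(w.1.adicCompletion L)] (Fin 3 → (w.1.adicCompletion L)) // IsVertex (galAdicCompletionMap (L := L) (IsCMField.complexConj L) hw) ϖ ((StdForm.antidiagonal 3).over (w.1.adicCompletion L)) M} => isOpen_setOf_actionHom_apply_eq (eA := eA) ha x
  have hUo := fun x : {M : Submodule 𝒪[(w.1.adicCompletion L)] (Fin 3 → (w.1.adicCompletion L)) // IsVertex (galAdicCompletionMap (L := L) (IsCMField.complexConj L) hw) ϖ ((StdForm.antidiagonal 3).over (w.1.adicCompletion L)) M} => isOpen_coe_unitaryLevel_gqs (eA := eA) hU hd x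
  have hUc := fun x : {M : Submodule 𝒪[(w.1.adicCompletion L)] (Fin 3 → (w.1.adicCompletion L)) // IsVertex (galAdicCompletionMap (L := L) (IsCMField.complexConj L) hw) ϖ ((StdForm.antidiagonal 3).over (w.1.adicCompletion L)) M} => isCompact_coe_unitaryLevel_gqs (eA := eA) hU hd x
  have hU6 : ∀ x y : {M : Submodule 𝒪[(w.1.adicCompletion L)] (Fin 3 → (w.1.adicCompletion L)) // IsVertex (galAdicCompletionMap (L := L) (IsCMField.complexConj L) hw) ϖ ((StdForm.antidiagonal 3).over (w.1.adicCompletion L)) M}, (latticeGraph (galAdicCompletionMap (L := L) (IsCMField.complexConj L) hw) ϖ ((StdForm.antidiagonal 3).over (w.1.adicCompletion L))).Adj x y → ((U x ⊔ U y : Subgroup (Gqs L v)) : Set (Gqs L v)) = (U x : Set (Gqs L v)) * (U y : Set (Gqs L v)) :=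
    fun x y hxy => coe_sup_unitaryLevel_gqs_eq_mul_of_adj (eA := eA) hU hd hxy
  have hU7 : ∀ x y z : {M : Submodule 𝒪[(w.1.adicCompletion L)] (Fin 3 → (w.1.adicCompletion L)) // IsVertex (galAdicCompletionMap (L := L) (IsCMField.complexConj L) hw) ϖ ((StdForm.antidiagonal 3).over (w.1.adicCompletion L)) M}, (latticeGraph (galAdicCompletionMap (L := L) (IsCMField.complexConj L) hw) ϖ ((StdForm.antidiagonal 3).over (w.1.adicCompletion L))).Adj x y → (latticeGraph (galAdicCompletionMap (L := L) (IsCMField.complexConj L) hw) ϖ ((StdForm.antidiagonal 3).over (w.1.adicCompletion L))).dist y z + 1 = (latticeGraph (galAdicCompletionMap (L := L) (IsCMField.complexConj L) hw) ϖ ((StdForm.antidiagonal 3).over (w.1.adicCompletion L))).dist x z →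
      ((U y : Subgroup (Gqs L v)) : Set (Gqs L v)) ⊆ (U x : Set (Gqs L v)) * (U z : Set (Gqs L v)) :=
    fun x y z hxy hyz => coe_unitaryLevel_gqs_subset_mul_of_adj_of_dist (eA := eA) hU hd hxy hyz
  have hUa := fun (g : Gqs L v) (x : {M : Submodule 𝒪[(w.1.adicCompletion L)] (Fin 3 → (w.1.adicCompletion L)) // IsVertex (galAdicCompletionMap (L := L) (IsCMField.complexConj L) hw) ϖ ((StdForm.antidiagonal 3).over (w.1.adicCompletion L)) M}) => unitaryLevel_gqs_actionHom_eq_map_conj (eA := eA) ha hU g x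
  have hσa : ∀ (g : Gqs L v) (d : (latticeGraph (galAdicCompletionMap (L := L) (IsCMField.complexConj L) hw) ϖ ((StdForm.antidiagonal 3).over (w.1.adicCompletion L))).edgeSet), τ.head ((a g).mapEdgeSet d) = a g (τ.head d) ∧ τ.tail ((a g).mapEdgeSet d) = a g (τ.tail d) := fun g d => by
    rw [ha]; exact head_mapEdgeSet_latticeGraphIso (galAdicCompletionMap (L := L) (IsCMField.complexConj L) hw) ϖ ((StdForm.antidiagonal 3).over (w.1.adicCompletion L)) hτ (eA g) d
  -- the chain representations (★ 41d-II, ★ 5a)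
  obtain ⟨τc, hτc⟩ := Representation.exists_rep_zeroChains (ι := {M : Submodule 𝒪[(w.1.adicCompletion L)] (Fin 3 → (w.1.adicCompletion L)) // IsVertex (galAdicCompletionMap (L := L) (IsCMField.complexConj L) hw) ϖ ((StdForm.antidiagonal 3).over (w.1.adicCompletion L)) M}) (G := (latticeGraph (galAdicCompletionMap (L := L) (IsCMField.complexConj L) hw) ϖ ((StdForm.antidiagonal 3).over (w.1.adicCompletion L)))) a r.ρ
  obtain ⟨τ₁c, hτ₁c⟩ := Representation.exists_rep_oneChains (G := (latticeGraph (galAdicCompletionMap (L := L) (IsCMField.complexConj L) hw) ϖ ((StdForm.antidiagonal 3).over (w.1.adicCompletion L)))) a r.ρ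
  obtain ⟨ρ₁, ρ₀, -, hρ₁, hρ₀, -⟩ := Representation.exists_reps_univ (ρ := r.ρ) hτc hτ₁c τ U hUa hσa
  -- stabilisers: `U ≤ P ≤ N(U)`, openness, compactness; the local representations are trivial on the levels and smooth
  have hUP₀ : ∀ i, U (xv i) ≤ P₀ i := fun i g hg => (hP₀ i g).2 (actionHom_apply_eq_of_mem (eA := eA) ha hU hg)
  have hPU₀ : ∀ i, P₀ i ≤ Subgroup.normalizer (U (xv i) : Set (Gqs L v)) := fun i g hg => mem_normalizer_unitaryLevel_gqs_of_apply_eq (eA := eA) ha hU ((hP₀ i g).1 hg)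
  have hP₀o : ∀ i, IsOpen (P₀ i : Set (Gqs L v)) := fun i => Representation.isOpen_of_forall_mem_iff_apply_eq hstab (hP₀ i)
  have hP₀c : ∀ i, IsCompact (P₀ i : Set (Gqs L v)) := fun i => by
    have hset : (P₀ i : Set (Gqs L v)) = {g : Gqs L v | a g (xv i) = xv i} := Set.ext fun g => hP₀ i g
    rw [hset]; exact isCompact_setOf_actionHom_apply_eq L v w hw eA ha (xv i)
  have hτ₀ : ∀ i (p : ↥(P₀ i)), (p : Gqs L v) ∈ U (xv i) → σ₀ i p = 1 := fun i p hp => by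
    refine LinearMap.ext fun x => Subtype.ext ?_
    rw [hσ₀, Module.End.one_apply]
    exact (Representation.mem_fixedPoints _ _ _).1 x.2 _ hp
  have hEadj : ∀ j, (latticeGraph (galAdicCompletionMap (L := L) (IsCMField.complexConj L) hw) ϖ ((StdForm.antidiagonal 3).over (w.1.adicCompletion L))).Adj (τ.head (xe j)) (τ.tail (xe j)) := fun j => τ.adj_head_tail (xe j)
  have hUP₁ : ∀ j, U (τ.head (xe j)) ⊔ U (τ.tail (xe j)) ≤ P₁ j := fun j g hg => by
    rw [hP₁, mapEdgeSet_eq_iff L v w hw eA ha τ hτ]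
    have hg' : g ∈ ((U (τ.head (xe j)) : Set (Gqs L v)) * (U (τ.tail (xe j)) : Set (Gqs L v))) := by
      rw [← hU6 _ _ (hEadj j)]; exact hg
    obtain ⟨u, hu, u', hu', rfl⟩ := hg'
    refine ⟨?_, ?_⟩
    · rw [map_mul, RelIso.coe_mul, Function.comp_apply, actionHom_apply_eq_of_mem_of_adj (eA := eA) ha hU hd hu' (hEadj j).symm,
        actionHom_apply_eq_of_mem (eA := eA) ha hU hu]
    · rw [map_mul, RelIso.coe_mul, Function.comp_apply, actionHom_apply_eq_of_mem (eA := eA) ha hU hu',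
        actionHom_apply_eq_of_mem_of_adj (eA := eA) ha hU hd hu (hEadj j)]
  have hPU₁ : ∀ j, P₁ j ≤ Subgroup.normalizer ((U (τ.head (xe j)) ⊔ U (τ.tail (xe j)) : Subgroup (Gqs L v)) : Set (Gqs L v)) := fun j g hg => by
    have hg' := ((mapEdgeSet_eq_iff L v w hw eA ha τ hτ g (xe j)).1 ((hP₁ j g).1 hg))
    exact mem_normalizer_sup_of_mem (mem_normalizer_unitaryLevel_gqs_of_apply_eq (eA := eA) ha hU hg'.1)
      (mem_normalizer_unitaryLevel_gqs_of_apply_eq (eA := eA) ha hU hg'.2)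
  have hP₁o : ∀ j, IsOpen (P₁ j : Set (Gqs L v)) := fun j => Representation.isOpen_of_forall_mem_iff_mapEdgeSet_eq hstab τ (hP₁ j)
  have hP₁c : ∀ j, IsCompact (P₁ j : Set (Gqs L v)) := fun j => by
    refine (isCompact_setOf_actionHom_apply_eq L v w hw eA ha (τ.head (xe j))).of_isClosed_subset ((P₁ j).isClosed_of_isOpen (hP₁o j)) ?_
    intro g hg
    exact ((mapEdgeSet_eq_iff L v w hw eA ha τ hτ g (xe j)).1 ((hP₁ j g).1 hg)).1
  have hEo : ∀ j, IsOpen ((U (τ.head (xe j)) ⊔ U (τ.tail (xe j)) : Subgroup (Gqs L v)) : Set (Gqs L v)) := fun j => isOpen_coe_sup_unitaryLevel_gqs (eA := eA) hU hd _ _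
  have hEc : ∀ j, IsCompact ((U (τ.head (xe j)) ⊔ U (τ.tail (xe j)) : Subgroup (Gqs L v)) : Set (Gqs L v)) := fun j =>
    isCompact_coe_sup_unitaryLevel_gqs_of_adj (eA := eA) hU hd (hEadj j)
  have hτ₁ : ∀ j (p : ↥(P₁ j)), (p : Gqs L v) ∈ U (τ.head (xe j)) ⊔ U (τ.tail (xe j)) → σ₁ j p = 1 := fun j p hp => by
    refine LinearMap.ext fun x => Subtype.ext ?_
    rw [hσ₁, Module.End.one_apply]
    exact (Representation.mem_fixedPoints _ _ _).1 x.2 _ hp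
  -- the `K`-type carriers are finite-dimensional (admissibility of `r`)
  haveI : ∀ i, FiniteDimensional ℂ ↥(r.ρ.fixedPoints (U (xv i))) := fun i => hadm.finite_fixedPoints ⟨U (xv i), hUo (xv i)⟩ (hUc (xv i))
  haveI : ∀ j, FiniteDimensional ℂ ↥(r.ρ.fixedPoints (U (τ.head (xe j)) ⊔ U (τ.tail (xe j)))) := fun j =>
    hadm.finite_fixedPoints ⟨U (τ.head (xe j)) ⊔ U (τ.tail (xe j)), hEo j⟩ (hEc j)
  -- the chains are smooth (★ 5a) and present `σ` (★ F-gen2, GLUE B inside)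
  have h1s : ρ₁.IsSmooth := Representation.isSmooth_rep_oneChains_univ hτ₁c hstab τ U hUo Set.univ hρ₁
  have h0s : ρ₀.IsSmooth := Representation.isSmooth_rep_zeroChains_univ hτc hstab U hUo Set.univ hρ₀
  obtain ⟨dC, ε, hdinj, hexact, hε⟩ :=
    Representation.exists_intertwiningMap_presentation_of_isIrreducible (ρ := r.ρ) hτc hτ₁c hT τ hσa U hUc hU6 hU7 hUa hρ he hρ₁ hρ₀
  refine ⟨_, _, inferInstance, inferInstance, inferInstance, inferInstance, ρ₁, ρ₀, dC, ε, h1s, h0s, hdinj, hexact, hε, fun r' => ?_⟩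
  -- the traced class `r′` is admissible; its local Hom-spaces from the `K`-types of `r` are finite-dimensional (§0 of ★ row 59)
  have hadm' : r'.ρ.IsAdmissible := F0P3cStCharTSScTracePackage.isAdmissible_smoothIrrep L v hns r'
  haveI : ∀ i, FiniteDimensional ℂ ↥(r'.ρ.fixedPoints (U (xv i))) := fun i => hadm'.finite_fixedPoints ⟨U (xv i), hUo (xv i)⟩ (hUc (xv i))
  haveI : ∀ j, FiniteDimensional ℂ ↥(r'.ρ.fixedPoints (U (τ.head (xe j)) ⊔ U (τ.tail (xe j)))) := fun j =>
    hadm'.finite_fixedPoints ⟨U (τ.head (xe j)) ⊔ U (τ.tail (xe j)), hEo j⟩ (hEc j)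
  haveI : ∀ i, FiniteDimensional ℂ ((σ₀ i).IntertwiningMap (r'.ρ.comp (P₀ i).subtype)) := fun i =>
    finiteDimensional_intertwiningMap_of_trivial_on r'.ρ (hUP₀ i) (σ₀ i) (hτ₀ i)
  haveI : ∀ j, FiniteDimensional ℂ ((σ₁ j).IntertwiningMap (r'.ρ.comp (P₁ j).subtype)) := fun j =>
    finiteDimensional_intertwiningMap_of_trivial_on r'.ρ (hUP₁ j) (σ₁ j) (hτ₁ j)
  -- the two BRIDGES (★ 57-B) at target `r′.ρ`
  have h0 := Representation.finrank_intertwiningMap_zeroChains_eq_sum (ρ := r.ρ) hτc hstab hρ U hUa hρ₀ xv idx₀ tr₀ hidx₀ hidx₀a htr₀ P₀ hP₀ σ₀ hσ₀ r'.ρ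
  have h1 := Representation.finrank_intertwiningMap_oneChains_eq_sum (ρ := r.ρ) hτ₁c hstab hρ τ U hUa hσa hρ₁ xe idx₁ tr₁ hidx₁ hidx₁a htr₁ P₁ hP₁ σ₁ hσ₁ r'.ρ
  -- `Hom_G(C_q(X), r′)` is finite-dimensional (★ 57-B ED. 2 §5: the equivalences + ★ 45, as LEMMAS — the `∃ e` statements are too dear to open at the datum)
  have hfd0 : FiniteDimensional ℂ (ρ₀.IntertwiningMap r'.ρ) :=
    Representation.finiteDimensional_intertwiningMap_zeroChains hτc hstab hρ U hUa hρ₀ xv idx₀ tr₀ hidx₀ hidx₀a htr₀ P₀ hP₀ σ₀ hσ₀ r'.ρ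
  have hfd1 : FiniteDimensional ℂ (ρ₁.IntertwiningMap r'.ρ) :=
    Representation.finiteDimensional_intertwiningMap_oneChains hτ₁c hstab hρ τ U hUa hσa hρ₁ xe idx₁ tr₁ hidx₁ hidx₁a htr₁ P₁ hP₁ σ₁ hσ₁ r'.ρ
  refine ⟨hfd0, hfd1, ?_⟩
  -- the GENERIC HALF on the traced `r′` with the two bridges
  exact r'.ρ.smoothTrace_epTwoFamilies_eq_finrank_sub νQv hadm' (fun i => U (xv i)) P₀ σ₀ f₀ (fun i => hUo (xv i)) (fun i => hUc (xv i)) hP₀c hUP₀ hPU₀ hτ₀ hfP₀ hf0₀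
    (fun j => U (τ.head (xe j)) ⊔ U (τ.tail (xe j))) P₁ σ₁ f₁ hEo hEc hP₁c hUP₁ hPU₁ hτ₁ hfP₁ hf0₁ ρ₁ ρ₀ h0 h1

/-! ## §2 THE PAIRING: `⟨χ_{[r′]}, χ_{[r]}⟩_e = dim Hom_G(C₀^r, r′) − dim Hom_G(C₁^r, r′)` when `f_EP^r` is a pseudo-coefficient of `[r]` -/

/-- **`⟨χ_{π′}, χ_π⟩_e = dim Hom_G(C₀(X)^π, π′) − dim Hom_G(C₁(X)^π, π′)` AT THE DATUM (modulo the pseudo-coefficient head of row 58).**  At a §12.5 datum `𝔇` on `(Gqs L v, H)` with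
★ PCT-OUT's letters (`hμG : 𝔇.μG = νQv`, `hreg`, `hM1`, `hWIF`, `hC1 hC2 hC3 hL2`), in the situation of §1: IF the Euler–Poincaré function `f_EP^π = Σ_i μ(P₀ i)⁻¹ f₀ i −
Σ_j μ(P₁ j)⁻¹ f₁ j` is a pseudo-coefficient of `π = IrrClass.mk r` (`hpc`, row 58's witnessed head S2a), THEN the presentation of §1 satisfies, for EVERY irreducible smooth `r′`,
`𝔇.innerG (𝔇.char [r′]) (𝔇.char [r]) = dim Hom_G(ρ₀, r′) − dim Hom_G(ρ₁, r′)`: ★ PCT-OUT gives `Tr r′(f_EP^π) = ⟨χ_{[r′]}, χ_{[r]}⟩_e`, and §1 computes the trace.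
NO `IsL2` ∕ `IsEllipticRep` ∕ `hsplit` antecedent. [cite: Rogawski1990, §12.6 p. 187; Prop. 12.6.1 (b) p. 188] [cite: SchneiderStuhler1997, §III.4 Thm. III.4.16] [cite: Kottwitz1988, §2] -/
theorem exists_presentation_innerG_char_eq_finrank_sub_of_isPseudoCoeff_epTwoFamilies
    (hns : ∀ w : PlacesOver L v, IsCMField.complexConj L • w.1 = w.1)
    (w : PlacesOver L v) (hw : IsCMField.complexConj L • w.1 = w.1) {ϖ : (w.1.adicCompletion L)} (hd : UnramifiedLocalConjDatum (galAdicCompletionMap (L := L) (IsCMField.complexConj L) hw) ϖ)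
    (eA : (Gqs L v) ≃ₜ* ↥(unitaryGroupOfForm (galAdicCompletionMap (L := L) (IsCMField.complexConj L) hw) ((StdForm.antidiagonal 3).over (w.1.adicCompletion L))))
    {a : (Gqs L v) →* ((latticeGraph (galAdicCompletionMap (L := L) (IsCMField.complexConj L) hw) ϖ ((StdForm.antidiagonal 3).over (w.1.adicCompletion L))) ≃g (latticeGraph (galAdicCompletionMap (L := L) (IsCMField.complexConj L) hw) ϖ ((StdForm.antidiagonal 3).over (w.1.adicCompletion L))))} (ha : ∀ g, a g = latticeGraphIso (galAdicCompletionMap (L := L) (IsCMField.complexConj L) hw) ϖ ((StdForm.antidiagonal 3).over (w.1.adicCompletion L)) (eA g))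
    [MeasurableSpace (Gqs L v)] [BorelSpace (Gqs L v)]
    [∀ γ : Gqs L v, MeasurableSpace (Gqs L v ⧸ Subgroup.centralizer ({γ} : Set (Gqs L v)))] [MeasurableSpace (Gqs L v ⧸ Subgroup.center (Gqs L v))]
    {H : Type} [Group H] [TopologicalSpace H] [IsTopologicalGroup H] [MeasurableSpace H]
    (νQv : Measure (Gqs L v)) [νQv.IsHaarMeasure] [νQv.IsMulRightInvariant]
    -- the §12.5 datum and ★ PCT-OUT's letters
    (𝔇 : EllipticData (Gqs L v) H) (hμG : 𝔇.μG = νQv)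
    (hreg : ∀ γ : Gqs L v, γ ∈ 𝔇.regG ↔ IsRegularElt (γ.val : GL (Fin 3) (UnitaryGroup.LocalRing L v)))
    (hM1 : ∀ π : IrrClass (Gqs L v), Measurable (𝔇.char π) ∧ LocallyIntegrable (𝔇.char π) 𝔇.μG ∧
      (∀ x ∈ 𝔇.regG, ∀ᶠ y in 𝓝 x, 𝔇.char π y = 𝔇.char π x) ∧
      ∀ φ : Gqs L v → ℂ, IsLocSmooth φ → π.smoothTrace 𝔇.μG φ = ∫ x, φ x * 𝔇.char π x ∂𝔇.μG)
    (hWIF : 𝔇.WeylIntegrationFormula) (hC1 : 𝔇.EllCartanSubset) (hC2 : 𝔇.EllCartanAE) (hC3 : 𝔇.NonEllCartanAE) (hL2 : 𝔇.L2CharOnTorusAll)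
    (τ : Orientation (latticeGraph (galAdicCompletionMap (L := L) (IsCMField.complexConj L) hw) ϖ ((StdForm.antidiagonal 3).over (w.1.adicCompletion L)))) (hτ : ∀ d, τ.tail d < τ.head d)
    {e : ℕ} {U : {M : Submodule 𝒪[(w.1.adicCompletion L)] (Fin 3 → (w.1.adicCompletion L)) // IsVertex (galAdicCompletionMap (L := L) (IsCMField.complexConj L) hw) ϖ ((StdForm.antidiagonal 3).over (w.1.adicCompletion L)) M} → Subgroup (Gqs L v)}
    (hU : ∀ x g, g ∈ U x ↔ mapGL ((eA g : ↥(unitaryGroupOfForm (galAdicCompletionMap (L := L) (IsCMField.complexConj L) hw) ((StdForm.antidiagonal 3).over (w.1.adicCompletion L)))) : GL (Fin 3) (w.1.adicCompletion L)) x.1 = x.1 ∧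
      x.1.map ((Matrix.toLin' ((((eA g : ↥(unitaryGroupOfForm (galAdicCompletionMap (L := L) (IsCMField.complexConj L) hw) ((StdForm.antidiagonal 3).over (w.1.adicCompletion L)))) : GL (Fin 3) (w.1.adicCompletion L)) : Matrix (Fin 3) (Fin 3) (w.1.adicCompletion L)) - 1)).restrictScalars 𝒪[(w.1.adicCompletion L)]) ≤ scaleLattice (ϖ ^ (e + 1)) x.1)
    (r : SmoothIrrep (Gqs L v)) {x₀ : {M : Submodule 𝒪[(w.1.adicCompletion L)] (Fin 3 → (w.1.adicCompletion L)) // IsVertex (galAdicCompletionMap (L := L) (IsCMField.complexConj L) hw) ϖ ((StdForm.antidiagonal 3).over (w.1.adicCompletion L)) M}} (he : r.ρ.fixedPoints (U x₀) ≠ ⊥)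
    -- vertex orbit data (★ 57-B letters)
    {ι₀ : Type} [Fintype ι₀] [DecidableEq ι₀] (xv : ι₀ → {M : Submodule 𝒪[(w.1.adicCompletion L)] (Fin 3 → (w.1.adicCompletion L)) // IsVertex (galAdicCompletionMap (L := L) (IsCMField.complexConj L) hw) ϖ ((StdForm.antidiagonal 3).over (w.1.adicCompletion L)) M}) (idx₀ : {M : Submodule 𝒪[(w.1.adicCompletion L)] (Fin 3 → (w.1.adicCompletion L)) // IsVertex (galAdicCompletionMap (L := L) (IsCMField.complexConj L) hw) ϖ ((StdForm.antidiagonal 3).over (w.1.adicCompletion L)) M} → ι₀) (tr₀ : {M : Submodule 𝒪[(w.1.adicCompletion L)] (Fin 3 → (w.1.adicCompletion L)) // IsVertex (galAdicCompletionMap (L := L) (IsCMField.complexConj L) hw) ϖ ((StdForm.antidiagonal 3).over (w.1.adicCompletion L)) M} → Gqs L v)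
    (hidx₀ : ∀ i, idx₀ (xv i) = i) (hidx₀a : ∀ (g : Gqs L v) (x : {M : Submodule 𝒪[(w.1.adicCompletion L)] (Fin 3 → (w.1.adicCompletion L)) // IsVertex (galAdicCompletionMap (L := L) (IsCMField.complexConj L) hw) ϖ ((StdForm.antidiagonal 3).over (w.1.adicCompletion L)) M}), idx₀ (a g x) = idx₀ x) (htr₀ : ∀ x, a (tr₀ x) (xv (idx₀ x)) = x)
    (P₀ : ι₀ → Subgroup (Gqs L v)) (hP₀ : ∀ i g, g ∈ P₀ i ↔ a g (xv i) = xv i)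
    (σ₀ : ∀ i, Representation ℂ ↥(P₀ i) ↥(r.ρ.fixedPoints (U (xv i))))
    (hσ₀ : ∀ (i : ι₀) (p : ↥(P₀ i)) (x : ↥(r.ρ.fixedPoints (U (xv i)))), ((σ₀ i p x : ↥(r.ρ.fixedPoints (U (xv i)))) : r.V) = r.ρ (p : Gqs L v) (x : r.V))
    -- edge orbit data (★ 57-B letters)
    {ι₁ : Type} [Fintype ι₁] [DecidableEq ι₁] (xe : ι₁ → (latticeGraph (galAdicCompletionMap (L := L) (IsCMField.complexConj L) hw) ϖ ((StdForm.antidiagonal 3).over (w.1.adicCompletion L))).edgeSet) (idx₁ : (latticeGraph (galAdicCompletionMap (L := L) (IsCMField.complexConj L) hw) ϖ ((StdForm.antidiagonal 3).over (w.1.adicCompletion L))).edgeSet → ι₁) (tr₁ : (latticeGraph (galAdicCompletionMap (L := L) (IsCMField.complexConj L) hw) ϖ ((StdForm.antidiagonal 3).over (w.1.adicCompletion L))).edgeSet → Gqs L v)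
    (hidx₁ : ∀ j, idx₁ (xe j) = j) (hidx₁a : ∀ (g : Gqs L v) (d : (latticeGraph (galAdicCompletionMap (L := L) (IsCMField.complexConj L) hw) ϖ ((StdForm.antidiagonal 3).over (w.1.adicCompletion L))).edgeSet), idx₁ ((a g).mapEdgeSet d) = idx₁ d)
    (htr₁ : ∀ d : (latticeGraph (galAdicCompletionMap (L := L) (IsCMField.complexConj L) hw) ϖ ((StdForm.antidiagonal 3).over (w.1.adicCompletion L))).edgeSet, (a (tr₁ d)).mapEdgeSet (xe (idx₁ d)) = d)
    (P₁ : ι₁ → Subgroup (Gqs L v)) (hP₁ : ∀ j g, g ∈ P₁ j ↔ (a g).mapEdgeSet (xe j) = xe j)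
    (σ₁ : ∀ j, Representation ℂ ↥(P₁ j) ↥(r.ρ.fixedPoints (U (τ.head (xe j)) ⊔ U (τ.tail (xe j)))))
    (hσ₁ : ∀ (j : ι₁) (p : ↥(P₁ j)) (x : ↥(r.ρ.fixedPoints (U (τ.head (xe j)) ⊔ U (τ.tail (xe j))))),
      ((σ₁ j p x : ↥(r.ρ.fixedPoints (U (τ.head (xe j)) ⊔ U (τ.tail (xe j))))) : r.V) = r.ρ (p : Gqs L v) (x : r.V))
    -- the `K`-type pieces (★ 42 letters)
    {f₀ : ι₀ → Gqs L v → ℂ} (hfP₀ : ∀ i (g : Gqs L v) (hg : g ∈ P₀ i), f₀ i g = (σ₀ i).character ⟨g, hg⟩⁻¹) (hf0₀ : ∀ i, ∀ g ∉ P₀ i, f₀ i g = 0)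
    {f₁ : ι₁ → Gqs L v → ℂ} (hfP₁ : ∀ j (g : Gqs L v) (hg : g ∈ P₁ j), f₁ j g = (σ₁ j).character ⟨g, hg⟩⁻¹) (hf0₁ : ∀ j, ∀ g ∉ P₁ j, f₁ j g = 0)
    -- row 58's witnessed head: the EP function IS a pseudo-coefficient of `σ`
    (hpc : 𝔇.IsPseudoCoeff (IrrClass.mk r) ((∑ i, ((νQv.real (P₀ i : Set (Gqs L v)) : ℂ))⁻¹ • f₀ i) - ∑ j, ((νQv.real (P₁ j : Set (Gqs L v)) : ℂ))⁻¹ • f₁ j)) :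
    ∃ (M₁ M₀ : Type) (_ : AddCommGroup M₁) (_ : Module ℂ M₁) (_ : AddCommGroup M₀) (_ : Module ℂ M₀)
      (ρ₁ : Representation ℂ (Gqs L v) M₁) (ρ₀ : Representation ℂ (Gqs L v) M₀) (dC : ρ₁.IntertwiningMap ρ₀) (ε : ρ₀.IntertwiningMap r.ρ),
      ρ₁.IsSmooth ∧ ρ₀.IsSmooth ∧ Function.Injective dC ∧ LinearMap.ker ε.toLinearMap = LinearMap.range dC.toLinearMap ∧ Function.Surjective ε ∧
      ∀ r' : SmoothIrrep (Gqs L v), ∃ (_ : FiniteDimensional ℂ (ρ₀.IntertwiningMap r'.ρ)) (_ : FiniteDimensional ℂ (ρ₁.IntertwiningMap r'.ρ)),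
        𝔇.innerG (𝔇.char (IrrClass.mk r')) (𝔇.char (IrrClass.mk r)) =
          (Module.finrank ℂ (ρ₀.IntertwiningMap r'.ρ) : ℂ) - (Module.finrank ℂ (ρ₁.IntertwiningMap r'.ρ) : ℂ) := by
  have hPCT := F0P3cStCharTSPctOut.pseudoCoeffTrace_Gqs L v hns νQv 𝔇 hμG hreg hM1 hWIF hC1 hC2 hC3 hL2
  obtain ⟨M₁, M₀, i₁, i₂, i₃, i₄, ρ₁, ρ₀, dC, ε, h1s, h0s, hdinj, hexact, hε, hall⟩ :=
    exists_presentation_smoothTrace_epTwoFamilies_eq_finrank_sub_at_datum L v hns w hw hd eA ha νQv τ hτ hU r he xv idx₀ tr₀ hidx₀ hidx₀a htr₀ P₀ hP₀ σ₀ hσ₀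
      xe idx₁ tr₁ hidx₁ hidx₁a htr₁ P₁ hP₁ σ₁ hσ₁ hfP₀ hf0₀ hfP₁ hf0₁
  refine ⟨M₁, M₀, i₁, i₂, i₃, i₄, ρ₁, ρ₀, dC, ε, h1s, h0s, hdinj, hexact, hε, fun r' => ?_⟩
  obtain ⟨hfd0, hfd1, hid⟩ := hall r'
  refine ⟨hfd0, hfd1, ?_⟩
  rw [← hPCT (IrrClass.mk r) (IrrClass.mk r') _ hpc, hμG, IrrClass.smoothTrace_mk]
  exact hid

/-! ## §3 CROSS-TRACE-ZERO: `tr r′(f_EP^r) = 0` when every smooth extension of `r` by `r′` splits and `Hom_G(r, r′) = 0` (EXT-ROAD v2 (S-A), the form (X3′) consumes) -/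

/-- **CROSS-TRACE-ZERO AT THE DATUM.**  In the situation of §1, for a second irreducible smooth `r′`: IF every SMOOTH extension `0 → r′ → E → r → 0` splits (`hsplit₂`, ★ (J′)'s letters at
`V := r.ρ`, `W := r′.ρ`) and `Hom_G(r, r′) = 0` (`hHom0`, e.g. `⟦r⟧ ≠ ⟦r′⟧`), THEN `tr r′(Σ_i μ(P₀ i)⁻¹ f₀ i − Σ_j μ(P₁ j)⁻¹ f₁ j) = 0`: §1 gives `dim Hom_G(C₀^r, r′) − dim Hom_G(C₁^r, r′)`,
and ★ (J′) `finrank_intertwiningMap_presentation_of_isSmooth` (the forward count, smooth pushout) gives `dim Hom_G(C₀^r, r′) = dim Hom_G(r, r′) + dim Hom_G(C₁^r, r′) = dim Hom_G(C₁^r, r′)`.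
(Contrapositive = the EXT-ROAD's (X1) reading: a non-zero cross trace forces a NON-SPLIT extension.) [cite: SchneiderStuhler1997, §III.4 Thm. III.4.16] [cite: Kottwitz1988, §2]
[cite: BernsteinZelevinsky1976, §2.1–§2.4] -/
theorem smoothTrace_epTwoFamilies_eq_zero_of_forall_extension_split_of_subsingleton_hom
    (hns : ∀ w : PlacesOver L v, IsCMField.complexConj L • w.1 = w.1)
    (w : PlacesOver L v) (hw : IsCMField.complexConj L • w.1 = w.1) {ϖ : (w.1.adicCompletion L)} (hd : UnramifiedLocalConjDatum (galAdicCompletionMap (L := L) (IsCMField.complexConj L) hw) ϖ)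
    (eA : (Gqs L v) ≃ₜ* ↥(unitaryGroupOfForm (galAdicCompletionMap (L := L) (IsCMField.complexConj L) hw) ((StdForm.antidiagonal 3).over (w.1.adicCompletion L))))
    {a : (Gqs L v) →* ((latticeGraph (galAdicCompletionMap (L := L) (IsCMField.complexConj L) hw) ϖ ((StdForm.antidiagonal 3).over (w.1.adicCompletion L))) ≃g (latticeGraph (galAdicCompletionMap (L := L) (IsCMField.complexConj L) hw) ϖ ((StdForm.antidiagonal 3).over (w.1.adicCompletion L))))} (ha : ∀ g, a g = latticeGraphIso (galAdicCompletionMap (L := L) (IsCMField.complexConj L) hw) ϖ ((StdForm.antidiagonal 3).over (w.1.adicCompletion L)) (eA g))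
    [MeasurableSpace (Gqs L v)] [BorelSpace (Gqs L v)]
    (νQv : Measure (Gqs L v)) [νQv.IsHaarMeasure]
    (τ : Orientation (latticeGraph (galAdicCompletionMap (L := L) (IsCMField.complexConj L) hw) ϖ ((StdForm.antidiagonal 3).over (w.1.adicCompletion L)))) (hτ : ∀ d, τ.tail d < τ.head d)
    {e : ℕ} {U : {M : Submodule 𝒪[(w.1.adicCompletion L)] (Fin 3 → (w.1.adicCompletion L)) // IsVertex (galAdicCompletionMap (L := L) (IsCMField.complexConj L) hw) ϖ ((StdForm.antidiagonal 3).over (w.1.adicCompletion L)) M} → Subgroup (Gqs L v)}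
    (hU : ∀ x g, g ∈ U x ↔ mapGL ((eA g : ↥(unitaryGroupOfForm (galAdicCompletionMap (L := L) (IsCMField.complexConj L) hw) ((StdForm.antidiagonal 3).over (w.1.adicCompletion L)))) : GL (Fin 3) (w.1.adicCompletion L)) x.1 = x.1 ∧
      x.1.map ((Matrix.toLin' ((((eA g : ↥(unitaryGroupOfForm (galAdicCompletionMap (L := L) (IsCMField.complexConj L) hw) ((StdForm.antidiagonal 3).over (w.1.adicCompletion L)))) : GL (Fin 3) (w.1.adicCompletion L)) : Matrix (Fin 3) (Fin 3) (w.1.adicCompletion L)) - 1)).restrictScalars 𝒪[(w.1.adicCompletion L)]) ≤ scaleLattice (ϖ ^ (e + 1)) x.1)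
    (r : SmoothIrrep (Gqs L v)) {x₀ : {M : Submodule 𝒪[(w.1.adicCompletion L)] (Fin 3 → (w.1.adicCompletion L)) // IsVertex (galAdicCompletionMap (L := L) (IsCMField.complexConj L) hw) ϖ ((StdForm.antidiagonal 3).over (w.1.adicCompletion L)) M}} (he : r.ρ.fixedPoints (U x₀) ≠ ⊥)
    -- vertex orbit data (★ 57-B letters)
    {ι₀ : Type} [Fintype ι₀] [DecidableEq ι₀] (xv : ι₀ → {M : Submodule 𝒪[(w.1.adicCompletion L)] (Fin 3 → (w.1.adicCompletion L)) // IsVertex (galAdicCompletionMap (L := L) (IsCMField.complexConj L) hw) ϖ ((StdForm.antidiagonal 3).over (w.1.adicCompletion L)) M}) (idx₀ : {M : Submodule 𝒪[(w.1.adicCompletion L)] (Fin 3 → (w.1.adicCompletion L)) // IsVertex (galAdicCompletionMap (L := L) (IsCMField.complexConj L) hw) ϖ ((StdForm.antidiagonal 3).over (w.1.adicCompletion L)) M} → ι₀) (tr₀ : {M : Submodule 𝒪[(w.1.adicCompletion L)] (Fin 3 → (w.1.adicCompletion L)) // IsVertex (galAdicCompletionMap (L := L) (IsCMField.complexConj L)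 hw) ϖ ((StdForm.antidiagonal 3).over (w.1.adicCompletion L)) M} → Gqs L v)
    (hidx₀ : ∀ i, idx₀ (xv i) = i) (hidx₀a : ∀ (g : Gqs L v) (x : {M : Submodule 𝒪[(w.1.adicCompletion L)] (Fin 3 → (w.1.adicCompletion L)) // IsVertex (galAdicCompletionMap (L := L) (IsCMField.complexConj L) hw) ϖ ((StdForm.antidiagonal 3).over (w.1.adicCompletion L)) M}), idx₀ (a g x) = idx₀ x) (htr₀ : ∀ x, a (tr₀ x) (xv (idx₀ x)) = x)
    (P₀ : ι₀ → Subgroup (Gqs L v)) (hP₀ : ∀ i g, g ∈ P₀ i ↔ a g (xv i) = xv i)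
    (σ₀ : ∀ i, Representation ℂ ↥(P₀ i) ↥(r.ρ.fixedPoints (U (xv i))))
    (hσ₀ : ∀ (i : ι₀) (p : ↥(P₀ i)) (x : ↥(r.ρ.fixedPoints (U (xv i)))), ((σ₀ i p x : ↥(r.ρ.fixedPoints (U (xv i)))) : r.V) = r.ρ (p : Gqs L v) (x : r.V))
    -- edge orbit data (★ 57-B letters)
    {ι₁ : Type} [Fintype ι₁] [DecidableEq ι₁] (xe : ι₁ → (latticeGraph (galAdicCompletionMap (L := L) (IsCMField.complexConj L) hw) ϖ ((StdForm.antidiagonal 3).over (w.1.adicCompletion L))).edgeSet) (idx₁ : (latticeGraph (galAdicCompletionMap (L := L) (IsCMField.complexConj L) hw) ϖ ((StdForm.antidiagonal 3).over (w.1.adicCompletion L))).edgeSet → ι₁) (tr₁ : (latticeGraph (galAdicCompletionMap (L := L) (IsCMField.complexConj L) hw) ϖ ((StdForm.antidiagonal 3).over (w.1.adicCompletion L))).edgeSet → Gqs L v)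
    (hidx₁ : ∀ j, idx₁ (xe j) = j) (hidx₁a : ∀ (g : Gqs L v) (d : (latticeGraph (galAdicCompletionMap (L := L) (IsCMField.complexConj L) hw) ϖ ((StdForm.antidiagonal 3).over (w.1.adicCompletion L))).edgeSet), idx₁ ((a g).mapEdgeSet d) = idx₁ d)
    (htr₁ : ∀ d : (latticeGraph (galAdicCompletionMap (L := L) (IsCMField.complexConj L) hw) ϖ ((StdForm.antidiagonal 3).over (w.1.adicCompletion L))).edgeSet, (a (tr₁ d)).mapEdgeSet (xe (idx₁ d)) = d)
    (P₁ : ι₁ → Subgroup (Gqs L v)) (hP₁ : ∀ j g, g ∈ P₁ j ↔ (a g).mapEdgeSet (xe j) = xe j)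
    (σ₁ : ∀ j, Representation ℂ ↥(P₁ j) ↥(r.ρ.fixedPoints (U (τ.head (xe j)) ⊔ U (τ.tail (xe j)))))
    (hσ₁ : ∀ (j : ι₁) (p : ↥(P₁ j)) (x : ↥(r.ρ.fixedPoints (U (τ.head (xe j)) ⊔ U (τ.tail (xe j))))),
      ((σ₁ j p x : ↥(r.ρ.fixedPoints (U (τ.head (xe j)) ⊔ U (τ.tail (xe j))))) : r.V) = r.ρ (p : Gqs L v) (x : r.V))
    -- the `K`-type pieces (★ 42 letters)
    {f₀ : ι₀ → Gqs L v → ℂ} (hfP₀ : ∀ i (g : Gqs L v) (hg : g ∈ P₀ i), f₀ i g = (σ₀ i).character ⟨g, hg⟩⁻¹) (hf0₀ : ∀ i, ∀ g ∉ P₀ i, f₀ i g = 0)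
    {f₁ : ι₁ → Gqs L v → ℂ} (hfP₁ : ∀ j (g : Gqs L v) (hg : g ∈ P₁ j), f₁ j g = (σ₁ j).character ⟨g, hg⟩⁻¹) (hf0₁ : ∀ j, ∀ g ∉ P₁ j, f₁ j g = 0)
    -- the CROSS letters: every SMOOTH extension of `r.ρ` BY `r′.ρ` splits (★ (J′)'s text at `V := r.ρ`, `W := r′.ρ`), and `Hom_G(r, r′) = 0`
    (r' : SmoothIrrep (Gqs L v))
    (hsplit₂ : ∀ (E : Type) [AddCommGroup E] [Module ℂ E] (ρE : Representation ℂ (Gqs L v) E), ρE.IsSmooth →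
      ∀ (i : r'.ρ.IntertwiningMap ρE) (p : ρE.IntertwiningMap r.ρ), Function.Injective i → LinearMap.ker p.toLinearMap = LinearMap.range i.toLinearMap →
        Function.Surjective p → ∃ s : r.ρ.IntertwiningMap ρE, p.comp s = Representation.IntertwiningMap.id r.ρ)
    (hHom0 : Subsingleton (r.ρ.IntertwiningMap r'.ρ)) :
    r'.ρ.smoothTrace νQv ((∑ i, ((νQv.real (P₀ i : Set (Gqs L v)) : ℂ))⁻¹ • f₀ i) - ∑ j, ((νQv.real (P₁ j : Set (Gqs L v)) : ℂ))⁻¹ • f₁ j) = 0 := by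
  obtain ⟨M₁, M₀, i₁, i₂, i₃, i₄, ρ₁, ρ₀, dC, ε, h1s, h0s, hdinj, hexact, hε, hall⟩ :=
    exists_presentation_smoothTrace_epTwoFamilies_eq_finrank_sub_at_datum L v hns w hw hd eA ha νQv τ hτ hU r he xv idx₀ tr₀ hidx₀ hidx₀a htr₀ P₀ hP₀ σ₀ hσ₀
      xe idx₁ tr₁ hidx₁ hidx₁a htr₁ P₁ hP₁ σ₁ hσ₁ hfP₀ hf0₀ hfP₁ hf0₁
  obtain ⟨hfd0, hfd1, hid⟩ := hall r'
  haveI := hfd0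
  haveI := hHom0
  have hcount := Literature.RepresentationTheory.finrank_intertwiningMap_presentation_of_isSmooth ρ₁ ρ₀ r.ρ r'.ρ dC ε h0s r'.isSmooth hdinj hexact hε hsplit₂
  rw [hid, hcount, Module.finrank_zero_of_subsingleton, zero_add, sub_self]

/-! ## §4 CROSS-NORM-ZERO: `⟨χ_{[r′]}, χ_{[r]}⟩_e = 0` under the same letters, when `f_EP^r` is a pseudo-coefficient of `[r]` -/

/-- **CROSS-NORM-ZERO AT THE DATUM (modulo the pseudo-coefficient head of row 58).**  In the situation of §2 (★ PCT-OUT's letters, `hpc`), for a second irreducible smooth `r′` with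
`hsplit₂` (every smooth extension of `r` by `r′` splits) and `hHom0` (`Hom_G(r, r′) = 0`): `𝔇.innerG (𝔇.char [r′]) (𝔇.char [r]) = 0` — ★ PCT-OUT turns the pairing into `tr r′(f_EP^r)`,
which vanishes by §3.  This is the CROSS twin of ★ row 59 `innerG_char_self_eq_one_of_isPseudoCoeff_epTwoFamilies`; EXT-ROAD v2 reads it contrapositively («`⟨χ_{π′}, χ_π⟩_e ≠ 0`,
`π ≠ π′` ⇒ some smooth extension of `π` by `π′` does not split»). [cite: Rogawski1990, §12.6 p. 187; Prop. 12.6.1 (b) p. 188] [cite: SchneiderStuhler1997, §III.4] [cite: Kottwitz1988, §2] -/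
theorem innerG_char_eq_zero_of_forall_extension_split_of_isPseudoCoeff_epTwoFamilies
    (hns : ∀ w : PlacesOver L v, IsCMField.complexConj L • w.1 = w.1)
    (w : PlacesOver L v) (hw : IsCMField.complexConj L • w.1 = w.1) {ϖ : (w.1.adicCompletion L)} (hd : UnramifiedLocalConjDatum (galAdicCompletionMap (L := L) (IsCMField.complexConj L) hw) ϖ)
    (eA : (Gqs L v) ≃ₜ* ↥(unitaryGroupOfForm (galAdicCompletionMap (L := L) (IsCMField.complexConj L) hw) ((StdForm.antidiagonal 3).over (w.1.adicCompletion L))))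
    {a : (Gqs L v) →* ((latticeGraph (galAdicCompletionMap (L := L) (IsCMField.complexConj L) hw) ϖ ((StdForm.antidiagonal 3).over (w.1.adicCompletion L))) ≃g (latticeGraph (galAdicCompletionMap (L := L) (IsCMField.complexConj L) hw) ϖ ((StdForm.antidiagonal 3).over (w.1.adicCompletion L))))} (ha : ∀ g, a g = latticeGraphIso (galAdicCompletionMap (L := L) (IsCMField.complexConj L) hw) ϖ ((StdForm.antidiagonal 3).over (w.1.adicCompletion L)) (eA g))
    [MeasurableSpace (Gqs L v)] [BorelSpace (Gqs L v)]
    [∀ γ : Gqs L v, MeasurableSpace (Gqs L v ⧸ Subgroup.centralizer ({γ} : Set (Gqs L v)))] [MeasurableSpace (Gqs L v ⧸ Subgroup.center (Gqs L v))]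
    {H : Type} [Group H] [TopologicalSpace H] [IsTopologicalGroup H] [MeasurableSpace H]
    (νQv : Measure (Gqs L v)) [νQv.IsHaarMeasure] [νQv.IsMulRightInvariant]
    -- the §12.5 datum and ★ PCT-OUT's letters
    (𝔇 : EllipticData (Gqs L v) H) (hμG : 𝔇.μG = νQv)
    (hreg : ∀ γ : Gqs L v, γ ∈ 𝔇.regG ↔ IsRegularElt (γ.val : GL (Fin 3) (UnitaryGroup.LocalRing L v)))
    (hM1 : ∀ π : IrrClass (Gqs L v), Measurable (𝔇.char π) ∧ LocallyIntegrable (𝔇.char π) 𝔇.μG ∧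
      (∀ x ∈ 𝔇.regG, ∀ᶠ y in 𝓝 x, 𝔇.char π y = 𝔇.char π x) ∧
      ∀ φ : Gqs L v → ℂ, IsLocSmooth φ → π.smoothTrace 𝔇.μG φ = ∫ x, φ x * 𝔇.char π x ∂𝔇.μG)
    (hWIF : 𝔇.WeylIntegrationFormula) (hC1 : 𝔇.EllCartanSubset) (hC2 : 𝔇.EllCartanAE) (hC3 : 𝔇.NonEllCartanAE) (hL2 : 𝔇.L2CharOnTorusAll)
    (τ : Orientation (latticeGraph (galAdicCompletionMap (L := L) (IsCMField.complexConj L) hw) ϖ ((StdForm.antidiagonal 3).over (w.1.adicCompletion L)))) (hτ : ∀ d, τ.tail d < τ.head d)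
    {e : ℕ} {U : {M : Submodule 𝒪[(w.1.adicCompletion L)] (Fin 3 → (w.1.adicCompletion L)) // IsVertex (galAdicCompletionMap (L := L) (IsCMField.complexConj L) hw) ϖ ((StdForm.antidiagonal 3).over (w.1.adicCompletion L)) M} → Subgroup (Gqs L v)}
    (hU : ∀ x g, g ∈ U x ↔ mapGL ((eA g : ↥(unitaryGroupOfForm (galAdicCompletionMap (L := L) (IsCMField.complexConj L) hw) ((StdForm.antidiagonal 3).over (w.1.adicCompletion L)))) : GL (Fin 3) (w.1.adicCompletion L)) x.1 = x.1 ∧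
      x.1.map ((Matrix.toLin' ((((eA g : ↥(unitaryGroupOfForm (galAdicCompletionMap (L := L) (IsCMField.complexConj L) hw) ((StdForm.antidiagonal 3).over (w.1.adicCompletion L)))) : GL (Fin 3) (w.1.adicCompletion L)) : Matrix (Fin 3) (Fin 3) (w.1.adicCompletion L)) - 1)).restrictScalars 𝒪[(w.1.adicCompletion L)]) ≤ scaleLattice (ϖ ^ (e + 1)) x.1)
    (r : SmoothIrrep (Gqs L v)) {x₀ : {M : Submodule 𝒪[(w.1.adicCompletion L)] (Fin 3 → (w.1.adicCompletion L)) // IsVertex (galAdicCompletionMap (L := L) (IsCMField.complexConj L) hw) ϖ ((StdForm.antidiagonal 3).over (w.1.adicCompletion L)) M}} (he : r.ρ.fixedPoints (U x₀) ≠ ⊥)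
    -- vertex orbit data (★ 57-B letters)
    {ι₀ : Type} [Fintype ι₀] [DecidableEq ι₀] (xv : ι₀ → {M : Submodule 𝒪[(w.1.adicCompletion L)] (Fin 3 → (w.1.adicCompletion L)) // IsVertex (galAdicCompletionMap (L := L) (IsCMField.complexConj L) hw) ϖ ((StdForm.antidiagonal 3).over (w.1.adicCompletion L)) M}) (idx₀ : {M : Submodule 𝒪[(w.1.adicCompletion L)] (Fin 3 → (w.1.adicCompletion L)) // IsVertex (galAdicCompletionMap (L := L) (IsCMField.complexConj L) hw) ϖ ((StdForm.antidiagonal 3).over (w.1.adicCompletion L)) M} → ι₀) (tr₀ : {M : Submodule 𝒪[(w.1.adicCompletion L)] (Fin 3 → (w.1.adicCompletion L)) // IsVertex (galAdicCompletionMap (L := L) (IsCMField.complexConj L) hw) ϖ ((StdForm.antidiagonal 3).over (w.1.adicCompletion L)) M} → Gqs L v)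
    (hidx₀ : ∀ i, idx₀ (xv i) = i) (hidx₀a : ∀ (g : Gqs L v) (x : {M : Submodule 𝒪[(w.1.adicCompletion L)] (Fin 3 → (w.1.adicCompletion L)) // IsVertex (galAdicCompletionMap (L := L) (IsCMField.complexConj L) hw) ϖ ((StdForm.antidiagonal 3).over (w.1.adicCompletion L)) M}), idx₀ (a g x) = idx₀ x) (htr₀ : ∀ x, a (tr₀ x) (xv (idx₀ x)) = x)
    (P₀ : ι₀ → Subgroup (Gqs L v)) (hP₀ : ∀ i g, g ∈ P₀ i ↔ a g (xv i) = xv i)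
    (σ₀ : ∀ i, Representation ℂ ↥(P₀ i) ↥(r.ρ.fixedPoints (U (xv i))))
    (hσ₀ : ∀ (i : ι₀) (p : ↥(P₀ i)) (x : ↥(r.ρ.fixedPoints (U (xv i)))), ((σ₀ i p x : ↥(r.ρ.fixedPoints (U (xv i)))) : r.V) = r.ρ (p : Gqs L v) (x : r.V))
    -- edge orbit data (★ 57-B letters)
    {ι₁ : Type} [Fintype ι₁] [DecidableEq ι₁] (xe : ι₁ → (latticeGraph (galAdicCompletionMap (L := L) (IsCMField.complexConj L) hw) ϖ ((StdForm.antidiagonal 3).over (w.1.adicCompletion L))).edgeSet) (idx₁ : (latticeGraph (galAdicCompletionMap (L := L) (IsCMField.complexConj L) hw) ϖ ((StdForm.antidiagonal 3).over (w.1.adicCompletion L))).edgeSet → ι₁) (tr₁ : (latticeGraph (galAdicCompletionMap (L := L) (IsCMField.complexConj L) hw) ϖ ((StdForm.antidiagonal 3).over (w.1.adicCompletion L))).edgeSet → Gqs L v)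
    (hidx₁ : ∀ j, idx₁ (xe j) = j) (hidx₁a : ∀ (g : Gqs L v) (d : (latticeGraph (galAdicCompletionMap (L := L) (IsCMField.complexConj L) hw) ϖ ((StdForm.antidiagonal 3).over (w.1.adicCompletion L))).edgeSet), idx₁ ((a g).mapEdgeSet d) = idx₁ d)
    (htr₁ : ∀ d : (latticeGraph (galAdicCompletionMap (L := L) (IsCMField.complexConj L) hw) ϖ ((StdForm.antidiagonal 3).over (w.1.adicCompletion L))).edgeSet, (a (tr₁ d)).mapEdgeSet (xe (idx₁ d)) = d)
    (P₁ : ι₁ → Subgroup (Gqs L v)) (hP₁ : ∀ j g, g ∈ P₁ j ↔ (a g).mapEdgeSet (xe j) = xe j)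
    (σ₁ : ∀ j, Representation ℂ ↥(P₁ j) ↥(r.ρ.fixedPoints (U (τ.head (xe j)) ⊔ U (τ.tail (xe j)))))
    (hσ₁ : ∀ (j : ι₁) (p : ↥(P₁ j)) (x : ↥(r.ρ.fixedPoints (U (τ.head (xe j)) ⊔ U (τ.tail (xe j))))),
      ((σ₁ j p x : ↥(r.ρ.fixedPoints (U (τ.head (xe j)) ⊔ U (τ.tail (xe j))))) : r.V) = r.ρ (p : Gqs L v) (x : r.V))
    -- the `K`-type pieces (★ 42 letters)
    {f₀ : ι₀ → Gqs L v → ℂ} (hfP₀ : ∀ i (g : Gqs L v) (hg : g ∈ P₀ i), f₀ i g = (σ₀ i).character ⟨g, hg⟩⁻¹) (hf0₀ : ∀ i, ∀ g ∉ P₀ i, f₀ i g = 0)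
    {f₁ : ι₁ → Gqs L v → ℂ} (hfP₁ : ∀ j (g : Gqs L v) (hg : g ∈ P₁ j), f₁ j g = (σ₁ j).character ⟨g, hg⟩⁻¹) (hf0₁ : ∀ j, ∀ g ∉ P₁ j, f₁ j g = 0)
    -- row 58's witnessed head: the EP function IS a pseudo-coefficient of `σ`
    (hpc : 𝔇.IsPseudoCoeff (IrrClass.mk r) ((∑ i, ((νQv.real (P₀ i : Set (Gqs L v)) : ℂ))⁻¹ • f₀ i) - ∑ j, ((νQv.real (P₁ j : Set (Gqs L v)) : ℂ))⁻¹ • f₁ j))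
    -- the CROSS letters: every SMOOTH extension of `r.ρ` BY `r′.ρ` splits (★ (J′)'s text at `V := r.ρ`, `W := r′.ρ`), and `Hom_G(r, r′) = 0`
    (r' : SmoothIrrep (Gqs L v))
    (hsplit₂ : ∀ (E : Type) [AddCommGroup E] [Module ℂ E] (ρE : Representation ℂ (Gqs L v) E), ρE.IsSmooth →
      ∀ (i : r'.ρ.IntertwiningMap ρE) (p : ρE.IntertwiningMap r.ρ), Function.Injective i → LinearMap.ker p.toLinearMap = LinearMap.range i.toLinearMap →
        Function.Surjective p → ∃ s : r.ρ.IntertwiningMap ρE, p.comp s = Representation.IntertwiningMap.id r.ρ)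
    (hHom0 : Subsingleton (r.ρ.IntertwiningMap r'.ρ)) :
    𝔇.innerG (𝔇.char (IrrClass.mk r')) (𝔇.char (IrrClass.mk r)) = 0 := by
  have hPCT := F0P3cStCharTSPctOut.pseudoCoeffTrace_Gqs L v hns νQv 𝔇 hμG hreg hM1 hWIF hC1 hC2 hC3 hL2
  rw [← hPCT (IrrClass.mk r) (IrrClass.mk r') _ hpc, hμG, IrrClass.smoothTrace_mk]
  exact smoothTrace_epTwoFamilies_eq_zero_of_forall_extension_split_of_subsingleton_hom L v hns w hw hd eA ha νQv τ hτ hU r he xv idx₀ tr₀ hidx₀ hidx₀a htr₀ P₀ hP₀ σ₀ hσ₀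
    xe idx₁ tr₁ hidx₁ hidx₁a htr₁ P₁ hP₁ σ₁ hσ₁ hfP₀ hf0₀ hfP₁ hf0₁ r' hsplit₂ hHom0

end Head

end Summit.HodgeConjecture.HodgeConjecture.Cruxes.H413.F0P3cStCharTSEPTracePairAtDatum

end
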